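import Summits.HodgeConjecture.HodgeConjecture.Theorems.F0P3cStCharTSDGFieldTwo     -- ★ p851405 (F0P3-p02) DG-FIELD-TWO: `continuous_dgFormulaTwo` (the rank-2 closed form); brings ★ DG-FIELD, `Ch12Sec5.EllipticData`
import HarnessLib

/-!
# F0 · P3c · line LH6 «StCharTS» ∕ ROAD «UP-TR» — «WEIGHT-ID H»: the `H`-side weight letter `√(∏_w |disc χ_{s.1}|_w · (∏_w |det s.1|_w)⁻¹) = (𝔇.DH s)²` under the
# field equation `eDH`, and its continuity ∕ measurability on `H_v = U(Φ₂)(L⁺_v) × U(Φ₁)(L⁺_v)` (Rogawski 1990 §4.9 p. 54, §12.5 p. 183)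

Cell `pub/hodgecm-mathlib`, crux H413 = `stmt-HodgeConjecture-24833` (lane `--supports … --as helper`); seat LH5-p02 (g7) ((H4c) letter-writer of ROAD «UP-TR», LEAD T14-21; asked
«now» by the (H4c) typing hand LH10-p02 (g10) 2026-09-02T18:33:27Z for the (H5)∕(A1′) call sites).  THEOREMS ONLY; sorry-free; no definition ∕ instance ∕ notation ∕ named fact;
★-only imports; axioms TRIO.  The rank-3 twin is ★ `F0P3cStCharTSWeightIdElliptic.DG_sq_eq_sqrt` (LH6-p02).

WHAT.  `H_v := (cmDatum L 2 Φ₂).Local v × (cmDatum L 1 Φ₁).Local v` (the organ's long form).  The (H4c)∕(H4s) socket letters carry the weight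
`D t := NNReal.sqrt ‹★ RUNG0 v5 :166 `-- eDH` radicand at s := ↑t›`; the WIF-H heads ((H5), by shape) carry an abstract `D i` pinned by `(𝔇.DH s)² = D i s`.  This file is the pin:
* §1 `DH_sq_eq_sqrt` — under `eDH`, `(𝔇.DH s)² = √(∏_w |disc χ_{s.1}|_w · (∏_w |det s.1|_w)⁻¹)`; `DH_pow_four_eq` — the same without roots;
* §2 `continuous_sqrt_dhRadicand` — the weight letter is continuous on `H_v` (★ `continuous_dgFormulaTwo` through `Prod.fst`); `measurable_sqrt_dhRadicand_subtype` — and measurable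
  along any subgroup `↥T` (the `hD i` binder of the (E4)-shape heads), for ANY σ-algebra on `H_v` finer than the Borel sets (`[MeasurableSpace H_v] [BorelSpace H_v]` binders, as
  the organ's).
HONEST LABEL: count-neutral plumbing; closes no organ.  HC_CM is proved only modulo the 7 printed citations (2 remaining: hLiu418 = `stmt-HodgeConjecture-24832`, h413 =
`stmt-HodgeConjecture-24833`) until rung 0 closes.

## References
* [Rogawski1990] J. D. Rogawski, *Automorphic Representations of Unitary Groups in Three Variables*, Ann. of Math. Stud. 123 (1990), §4.9 p. 54 (`D_H`), §12.5 p. 183.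
-/

set_option autoImplicit false
-- the mandated namespace has the single-problem summit's repeated segment (`HodgeConjecture.HodgeConjecture`)
set_option linter.dupNamespace false

noncomputable section

open MeasureTheory Filter Topology Polynomial
open NumberField IsDedekindDomain
open scoped NNReal Matrix MatrixGroups
open Literature.NumberTheory.Automorphic Literature.NumberTheory.Automorphic.UnitaryGroup
open Literature.NumberTheory.Rogawski1990

namespace Summit.HodgeConjecture.HodgeConjecture.Cruxes.H413.F0P3cStCharTSWeightIdEllipticH

variable (L : Type) [Field L] [NumberField L] [IsCMField L] (v : HeightOneSpectrum (𝓞 ↥(maximalRealSubfield L)))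

/-! ## §1 `(𝔇.DH s)² = √(radicand)` under `eDH` -/

/-- **`(𝔇.DH s)² = √(∏_w |disc χ_{s.1}|_w · (∏_w |det s.1|_w)⁻¹)`** under the (S-𝔇) datum's `D_H` field equation (★ RUNG0 v5's `-- eDH` text): the square of the `H`-side Weyl
discriminant is the square root of `|disc(χ_{s.1}) ∕ det(s.1)|` — the tube-Jacobian weight of ROAD «UP-TR»'s (H4s)∕(H4c) socket letters. [cite: Rogawski1990, §4.9 p. 54; §12.5 p. 183] -/
theorem DH_sq_eq_sqrt [MeasurableSpace (Gqs L v)]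
    [∀ γ : Gqs L v, MeasurableSpace (Gqs L v ⧸ Subgroup.centralizer ({γ} : Set (Gqs L v)))] [MeasurableSpace (Gqs L v ⧸ Subgroup.center (Gqs L v))]
    [MeasurableSpace ((UnitaryGroup.cmDatum L 2 (Matrix.of fun i j : Fin 2 => if i.val + j.val + 1 = 2 then (1 : L) else 0)).Local v × (UnitaryGroup.cmDatum L 1 (Matrix.of fun i j : Fin 1 => if i.val + j.val + 1 = 1 then (1 : L) else 0)).Local v)]
    (𝔇 : Ch12Sec5.EllipticData (Gqs L v) ((UnitaryGroup.cmDatum L 2 (Matrix.of fun i j : Fin 2 => if i.val + j.val + 1 = 2 then (1 : L) else 0)).Local v × (UnitaryGroup.cmDatum L 1 (Matrix.of fun i j : Fin 1 => if i.val + j.val + 1 = 1 then (1 : L) else 0)).Local v))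
    (hDH : ∀ s : ((UnitaryGroup.cmDatum L 2 (Matrix.of fun i j : Fin 2 => if i.val + j.val + 1 = 2 then (1 : L) else 0)).Local v × (UnitaryGroup.cmDatum L 1 (Matrix.of fun i j : Fin 1 => if i.val + j.val + 1 = 1 then (1 : L) else 0)).Local v), 𝔇.DH s = ((NNReal.sqrt (NNReal.sqrt ((∏ w : PlacesOver L v, Literature.NumberTheory.GaloisRepresentations.IsNonarchimedeanLocalField.normAbs (w.1.adicCompletion L) (((s.1.val : GL (Fin 2) (UnitaryGroup.LocalRing L v)).val.charpoly.discr) w)) * (∏ w : PlacesOver L v, Literature.NumberTheory.GaloisRepresentations.IsNonarchimedeanLocalField.normAbs (w.1.adicCompletion L) (((s.1.val : GL (Fin 2) (UnitaryGroup.LocalRing L v)).val.det) w))⁻¹)) : ℝ≥0) : ℝ))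
    (s : ((UnitaryGroup.cmDatum L 2 (Matrix.of fun i j : Fin 2 => if i.val + j.val + 1 = 2 then (1 : L) else 0)).Local v × (UnitaryGroup.cmDatum L 1 (Matrix.of fun i j : Fin 1 => if i.val + j.val + 1 = 1 then (1 : L) else 0)).Local v)) :
    (𝔇.DH s) ^ 2 = ((NNReal.sqrt
        ((∏ w : PlacesOver L v, Literature.NumberTheory.GaloisRepresentations.IsNonarchimedeanLocalField.normAbs (w.1.adicCompletion L)
            (((s.1.val : GL (Fin 2) (UnitaryGroup.LocalRing L v)).val.charpoly.discr) w)) *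
          (∏ w : PlacesOver L v, Literature.NumberTheory.GaloisRepresentations.IsNonarchimedeanLocalField.normAbs (w.1.adicCompletion L)
            (((s.1.val : GL (Fin 2) (UnitaryGroup.LocalRing L v)).val.det) w))⁻¹) : ℝ≥0) : ℝ) := by
  rw [hDH s, ← NNReal.coe_pow, NNReal.sq_sqrt]

/-- **`(𝔇.DH s)⁴ = ∏_w |disc χ_{s.1}|_w · (∏_w |det s.1|_w)⁻¹`** — the same without roots. [cite: Rogawski1990, §4.9 p. 54] -/
theorem DH_pow_four_eq [MeasurableSpace (Gqs L v)]
    [∀ γ : Gqs L v, MeasurableSpace (Gqs L v ⧸ Subgroup.centralizer ({γ} : Set (Gqs L v)))] [MeasurableSpace (Gqs L v ⧸ Subgroup.center (Gqs L v))]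
    [MeasurableSpace ((UnitaryGroup.cmDatum L 2 (Matrix.of fun i j : Fin 2 => if i.val + j.val + 1 = 2 then (1 : L) else 0)).Local v × (UnitaryGroup.cmDatum L 1 (Matrix.of fun i j : Fin 1 => if i.val + j.val + 1 = 1 then (1 : L) else 0)).Local v)]
    (𝔇 : Ch12Sec5.EllipticData (Gqs L v) ((UnitaryGroup.cmDatum L 2 (Matrix.of fun i j : Fin 2 => if i.val + j.val + 1 = 2 then (1 : L) else 0)).Local v × (UnitaryGroup.cmDatum L 1 (Matrix.of fun i j : Fin 1 => if i.val + j.val + 1 = 1 then (1 : L) else 0)).Local v))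
    (hDH : ∀ s : ((UnitaryGroup.cmDatum L 2 (Matrix.of fun i j : Fin 2 => if i.val + j.val + 1 = 2 then (1 : L) else 0)).Local v × (UnitaryGroup.cmDatum L 1 (Matrix.of fun i j : Fin 1 => if i.val + j.val + 1 = 1 then (1 : L) else 0)).Local v), 𝔇.DH s = ((NNReal.sqrt (NNReal.sqrt ((∏ w : PlacesOver L v, Literature.NumberTheory.GaloisRepresentations.IsNonarchimedeanLocalField.normAbs (w.1.adicCompletion L) (((s.1.val : GL (Fin 2) (UnitaryGroup.LocalRing L v)).val.charpoly.discr) w)) * (∏ w : PlacesOver L v, Literature.NumberTheory.GaloisRepresentations.IsNonarchimedeanLocalField.normAbs (w.1.adicCompletion L) (((s.1.val : GL (Fin 2) (UnitaryGroup.LocalRing L v)).val.det) w))⁻¹)) : ℝ≥0) : ℝ))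
    (s : ((UnitaryGroup.cmDatum L 2 (Matrix.of fun i j : Fin 2 => if i.val + j.val + 1 = 2 then (1 : L) else 0)).Local v × (UnitaryGroup.cmDatum L 1 (Matrix.of fun i j : Fin 1 => if i.val + j.val + 1 = 1 then (1 : L) else 0)).Local v)) :
    (𝔇.DH s) ^ 4 = (((∏ w : PlacesOver L v, Literature.NumberTheory.GaloisRepresentations.IsNonarchimedeanLocalField.normAbs (w.1.adicCompletion L)
            (((s.1.val : GL (Fin 2) (UnitaryGroup.LocalRing L v)).val.charpoly.discr) w)) *
          (∏ w : PlacesOver L v, Literature.NumberTheory.GaloisRepresentations.IsNonarchimedeanLocalField.normAbs (w.1.adicCompletion L)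
            (((s.1.val : GL (Fin 2) (UnitaryGroup.LocalRing L v)).val.det) w))⁻¹ : ℝ≥0) : ℝ) := by
  rw [show (4 : ℕ) = 2 * 2 from rfl, pow_mul, DH_sq_eq_sqrt L v 𝔇 hDH s, ← NNReal.coe_pow, NNReal.sq_sqrt]

/-! ## §2 The weight letter `s ↦ √(∏_w |disc χ_{s.1}|_w · (∏_w |det s.1|_w)⁻¹)` is continuous and measurable along every subgroup -/

/-- The `H`-side weight letter is continuous on `H_v`: it is the square of ★ DG-FIELD-TWO's continuous closed form `√√(·)` read through the first projection.
[cite: Rogawski1990, §4.9 p. 54; §12.5 p. 183] -/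
theorem continuous_sqrt_dhRadicand :
    Continuous fun s : ((UnitaryGroup.cmDatum L 2 (Matrix.of fun i j : Fin 2 => if i.val + j.val + 1 = 2 then (1 : L) else 0)).Local v × (UnitaryGroup.cmDatum L 1 (Matrix.of fun i j : Fin 1 => if i.val + j.val + 1 = 1 then (1 : L) else 0)).Local v) =>
      NNReal.sqrt
        ((∏ w : PlacesOver L v, Literature.NumberTheory.GaloisRepresentations.IsNonarchimedeanLocalField.normAbs (w.1.adicCompletion L)
            (((s.1.val : GL (Fin 2) (UnitaryGroup.LocalRing L v)).val.charpoly.discr) w)) *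
          (∏ w : PlacesOver L v, Literature.NumberTheory.GaloisRepresentations.IsNonarchimedeanLocalField.normAbs (w.1.adicCompletion L)
            (((s.1.val : GL (Fin 2) (UnitaryGroup.LocalRing L v)).val.det) w))⁻¹) := by
  have h1 : Continuous fun s : ((UnitaryGroup.cmDatum L 2 (Matrix.of fun i j : Fin 2 => if i.val + j.val + 1 = 2 then (1 : L) else 0)).Local v × (UnitaryGroup.cmDatum L 1 (Matrix.of fun i j : Fin 1 => if i.val + j.val + 1 = 1 then (1 : L) else 0)).Local v) =>
      ((NNReal.sqrt (NNReal.sqrt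
        ((∏ w : PlacesOver L v, Literature.NumberTheory.GaloisRepresentations.IsNonarchimedeanLocalField.normAbs (w.1.adicCompletion L)
            (((s.1.val : GL (Fin 2) (UnitaryGroup.LocalRing L v)).val.charpoly.discr) w)) *
          (∏ w : PlacesOver L v, Literature.NumberTheory.GaloisRepresentations.IsNonarchimedeanLocalField.normAbs (w.1.adicCompletion L)
            (((s.1.val : GL (Fin 2) (UnitaryGroup.LocalRing L v)).val.det) w))⁻¹)) : ℝ≥0) : ℝ) :=
    (F0P3cStCharTSDGFieldTwo.continuous_dgFormulaTwo L v (Matrix.of fun i j : Fin 2 => if i.val + j.val + 1 = 2 then (1 : L) else 0)).comp continuous_fst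
  have h2 := (continuous_real_toNNReal.comp h1).pow 2
  convert h2 using 1
  funext s
  simp only [Pi.pow_apply, Function.comp_apply, Real.toNNReal_coe, NNReal.sq_sqrt]

/-- The `H`-side weight letter is measurable along every subgroup `↥T ⊆ H_v`, for every σ-algebra on `H_v` generated by the Borel sets (the organ's `[MeasurableSpace H_v]
[BorelSpace H_v]` binders) — the `hD i` input of the (E4)-shape WIF-H heads. [cite: Rogawski1990, §12.5 p. 183] -/
theorem measurable_sqrt_dhRadicand_subtype
    [MeasurableSpace ((UnitaryGroup.cmDatum L 2 (Matrix.of fun i j : Fin 2 => if i.val + j.val + 1 = 2 then (1 : L) else 0)).Local v × (UnitaryGroup.cmDatum L 1 (Matrix.of fun i j : Fin 1 => if i.val + j.val + 1 = 1 then (1 : L) else 0)).Local v)]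
    [BorelSpace ((UnitaryGroup.cmDatum L 2 (Matrix.of fun i j : Fin 2 => if i.val + j.val + 1 = 2 then (1 : L) else 0)).Local v × (UnitaryGroup.cmDatum L 1 (Matrix.of fun i j : Fin 1 => if i.val + j.val + 1 = 1 then (1 : L) else 0)).Local v)]
    (T : Subgroup ((UnitaryGroup.cmDatum L 2 (Matrix.of fun i j : Fin 2 => if i.val + j.val + 1 = 2 then (1 : L) else 0)).Local v × (UnitaryGroup.cmDatum L 1 (Matrix.of fun i j : Fin 1 => if i.val + j.val + 1 = 1 then (1 : L) else 0)).Local v)) :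
    Measurable fun t : ↥T =>
      NNReal.sqrt
        ((∏ w : PlacesOver L v, Literature.NumberTheory.GaloisRepresentations.IsNonarchimedeanLocalField.normAbs (w.1.adicCompletion L)
            ((((t : ((UnitaryGroup.cmDatum L 2 (Matrix.of fun i j : Fin 2 => if i.val + j.val + 1 = 2 then (1 : L) else 0)).Local v × (UnitaryGroup.cmDatum L 1 (Matrix.of fun i j : Fin 1 => if i.val + j.val + 1 = 1 then (1 : L) else 0)).Local v)).1.val : GL (Fin 2) (UnitaryGroup.LocalRing L v)).val.charpoly.discr) w)) *
          (∏ w : PlacesOver L v, Literature.NumberTheory.GaloisRepresentations.IsNonarchimedeanLocalField.normAbs (w.1.adicCompletion L)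
            ((((t : ((UnitaryGroup.cmDatum L 2 (Matrix.of fun i j : Fin 2 => if i.val + j.val + 1 = 2 then (1 : L) else 0)).Local v × (UnitaryGroup.cmDatum L 1 (Matrix.of fun i j : Fin 1 => if i.val + j.val + 1 = 1 then (1 : L) else 0)).Local v)).1.val : GL (Fin 2) (UnitaryGroup.LocalRing L v)).val.det) w))⁻¹) :=
  (continuous_sqrt_dhRadicand L v).measurable.comp measurable_subtype_coe

end Summit.HodgeConjecture.HodgeConjecture.Cruxes.H413.F0P3cStCharTSWeightIdEllipticH

end
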